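import Summits.CriticalPhenomena.PercolationContinuityZ3.Theorems.SahiMasterFamilySupport

/-!
# Triangle families and wedge families are never zero flags (every order)

Unit `prim-master-conj` (crux anchor stmt-CriticalPhenomena-4575), gen 10; memo HOME/prim-master-conj/TIGHTNESS-II.md §2–§3.
Preliminaries for `SahiMasterFamilyTrianglePatterns`: the events `x_e ∨ x_f` (edges of the OR-triangle on three coordinates
`e₁, e₂, e₃`), the wedge `x_{e₃} ∨ x_{e₁}x_{e₂}`, the absorbers `x_{e₁} ∨ x_{e₂} ∨ x_{e₃}`, `Ω`; and the two ORDER-FREE non-vanishing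
patterns of the recursive zero-flag class:
* `not_suppZeroFlag_of_triFam`: a family whose members are triangle edges or absorbers, all three edges occurring, is not in `Z_k`;
* `not_suppZeroFlag_of_wedgeFam`: a family whose members are the wedge, the edge `x_{e₁} ∨ x_{e₂}` or absorbers, both occurring, is not in `Z_k`.
Proof: induction on the order along the recursive definition of `Z_k` — peeling an absorber, or shrinking an absorber against an edge,
reproduces the family type one order down; a family of pairwise dependent increasing events has no zero-flag certificate
(`exists_indepPair_of_suppZeroFlag`, every order).  These are the `C = ∅` base cases of the triangle patterns over a cored set.
Pure combinatorics; axioms standard. [this work]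
-/

noncomputable section

open scoped Classical

namespace Summit.CriticalPhenomena.PercolationContinuityZ3.Theorems

namespace TrianglePatterns

open Finset Function
open Literature.Probability.LatticeModels.Kahn2022 (Affects)
open Literature.Probability.Percolation (DeterminedBy determinedBy_iff)

variable {ι : Type} [Fintype ι]

/-! ### A zero flag of order `≥ 2` contains an independent pair -/

omit [Fintype ι] in
/-- A zero flag of order `k + 2` has two distinct slots forming a zero flag of order `2`. [this work] -/
theorem exists_indepPair_of_suppZeroFlag :
    ∀ (k : ℕ) (U : Fin (k + 2) → Set (Set ι)), SuppZeroFlag (k + 2) U → ∃ j j' : Fin (k + 2), j ≠ j' ∧ SuppZeroFlag 2 ![U j, U j']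
  | 0, U, h => ⟨0, 1, by decide, (suppZeroFlag_two_eta U).1 h⟩
  | k + 1, U, h => by
    obtain ⟨i, hi, -⟩ := h
    obtain ⟨j, j', hjj', h2⟩ := exists_indepPair_of_suppZeroFlag k _ hi
    exact ⟨i.succAbove j, i.succAbove j', fun h => hjj' (Fin.succAbove_right_injective h), h2⟩

/-- Two increasing events sharing an essential coordinate are not a zero flag of order `2`. [this work] -/
theorem not_suppZeroFlag_two_of_affects {X Y : Set (Set ι)} (hX : IsUpperSet X) (hY : IsUpperSet Y) {i : ι}
    (hiX : Affects X i) (hiY : Affects Y i) : ¬ SuppZeroFlag 2 ![X, Y] := by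
  intro h
  rw [suppZeroFlag_two_iff hX hY] at h
  exact Finset.disjoint_left.1 h (mem_esupp.2 hiX) (mem_esupp.2 hiY)

/-- A family of increasing events every two of which share an essential coordinate is not a zero flag (order `≥ 2`). [this work] -/
theorem not_suppZeroFlag_of_pairwise_affects {k : ℕ} (U : Fin (k + 2) → Set (Set ι)) (hU : ∀ j, IsUpperSet (U j))
    (h : ∀ j j' : Fin (k + 2), j ≠ j' → ∃ i, Affects (U j) i ∧ Affects (U j') i) : ¬ SuppZeroFlag (k + 2) U := by
  intro hZ
  obtain ⟨j, j', hjj', h2⟩ := exists_indepPair_of_suppZeroFlag k U hZ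
  obtain ⟨i, hij, hij'⟩ := h j j' hjj'
  exact not_suppZeroFlag_two_of_affects (hU j) (hU j') hij hij' h2

/-! ### The events: edges of the OR-triangle, the wedge, the absorbers -/

section Events

variable (e₁ e₂ e₃ : ι)

omit [Fintype ι]

/-- `x_e ∨ x_f`. [this work] -/
def orEv (e f : ι) : Set (Set ι) := {ω | e ∈ ω ∨ f ∈ ω}

/-- `x_{e₁} ∨ x_{e₂} ∨ x_{e₃}`. [this work] -/
def or3Ev : Set (Set ι) := {ω | e₁ ∈ ω ∨ e₂ ∈ ω ∨ e₃ ∈ ω}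

/-- The wedge `x_{e₃} ∨ x_{e₁} x_{e₂}`. [this work] -/
def wedgeEv : Set (Set ι) := {ω | e₃ ∈ ω ∨ (e₁ ∈ ω ∧ e₂ ∈ ω)}

/-- An edge of the OR-triangle on `e₁, e₂, e₃`. [this work] -/
def IsEdge (A : Set (Set ι)) : Prop := A = orEv e₂ e₃ ∨ A = orEv e₁ e₃ ∨ A = orEv e₁ e₂

/-- An absorber: `x_{e₁} ∨ x_{e₂} ∨ x_{e₃}` or the sure event. [this work] -/
def IsAbsorber (A : Set (Set ι)) : Prop := A = or3Ev e₁ e₂ e₃ ∨ A = Set.univ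

/-- `x_e ∨ x_f` is increasing. [this work] -/
theorem isUpperSet_orEv (e f : ι) : IsUpperSet (orEv e f) := fun _ _ hle h => h.imp (fun h => hle h) (fun h => hle h)

/-- `x₁ ∨ x₂ ∨ x₃` is increasing. [this work] -/
theorem isUpperSet_or3Ev : IsUpperSet (or3Ev e₁ e₂ e₃) :=
  fun _ _ hle h => h.imp (fun h => hle h) (fun h => h.imp (fun h => hle h) (fun h => hle h))

/-- The wedge is increasing. [this work] -/
theorem isUpperSet_wedgeEv : IsUpperSet (wedgeEv e₁ e₂ e₃) :=
  fun _ _ hle h => h.imp (fun h => hle h) (fun h => ⟨hle h.1, hle h.2⟩)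

/-- `x_e ∨ x_f` uses `e`. [this work] -/
theorem affects_orEv_left (e f : ι) : Affects (orEv e f) e :=
  ⟨∅, by simp [orEv], by simp [orEv]⟩

/-- `x_e ∨ x_f` uses `f`. [this work] -/
theorem affects_orEv_right (e f : ι) : Affects (orEv e f) f :=
  ⟨∅, by simp [orEv], by simp [orEv]⟩

variable {e₁ e₂ e₃}

/-- The wedge `x₃ ∨ x₁x₂` uses `e₁`. [this work] -/
theorem affects_wedgeEv (h₂₃ : e₂ ≠ e₃) (h₁₂ : e₁ ≠ e₂) : Affects (wedgeEv e₁ e₂ e₃) e₁ :=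
  ⟨{e₂}, by simp [wedgeEv, h₂₃.symm, h₁₂], by simp [wedgeEv]⟩

/-- Edges are increasing. [this work] -/
theorem isUpperSet_of_isEdge {A : Set (Set ι)} (h : IsEdge e₁ e₂ e₃ A) : IsUpperSet A := by
  rcases h with rfl | rfl | rfl <;> exact isUpperSet_orEv _ _

/-- Absorbers are increasing. [this work] -/
theorem isUpperSet_of_isAbsorber {A : Set (Set ι)} (h : IsAbsorber e₁ e₂ e₃ A) : IsUpperSet A := by
  rcases h with rfl | rfl
  · exact isUpperSet_or3Ev _ _ _
  · exact isUpperSet_univ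

/-- Every two edges of the triangle share an essential coordinate. [this work] -/
theorem exists_affects_of_isEdge {X Y : Set (Set ι)} (hX : IsEdge e₁ e₂ e₃ X) (hY : IsEdge e₁ e₂ e₃ Y) :
    ∃ i, Affects X i ∧ Affects Y i := by
  rcases hX with rfl | rfl | rfl <;> rcases hY with rfl | rfl | rfl
  · exact ⟨e₂, affects_orEv_left _ _, affects_orEv_left _ _⟩
  · exact ⟨e₃, affects_orEv_right _ _, affects_orEv_right _ _⟩
  · exact ⟨e₂, affects_orEv_left _ _, affects_orEv_right _ _⟩
  · exact ⟨e₃, affects_orEv_right _ _, affects_orEv_right _ _⟩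
  · exact ⟨e₁, affects_orEv_left _ _, affects_orEv_left _ _⟩
  · exact ⟨e₁, affects_orEv_left _ _, affects_orEv_left _ _⟩
  · exact ⟨e₂, affects_orEv_right _ _, affects_orEv_left _ _⟩
  · exact ⟨e₁, affects_orEv_left _ _, affects_orEv_left _ _⟩
  · exact ⟨e₁, affects_orEv_left _ _, affects_orEv_left _ _⟩

/-- An edge is contained in every absorber. [this work] -/
theorem subset_of_isEdge_of_isAbsorber {X A : Set (Set ι)} (hX : IsEdge e₁ e₂ e₃ X) (hA : IsAbsorber e₁ e₂ e₃ A) : X ⊆ A := by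
  rcases hA with rfl | rfl
  · rcases hX with rfl | rfl | rfl <;> intro ω hω <;> rcases hω with h | h <;> simp [or3Ev, h]
  · exact Set.subset_univ _

/-- The wedge is contained in every absorber. [this work] -/
theorem wedgeEv_subset_of_isAbsorber {A : Set (Set ι)} (hA : IsAbsorber e₁ e₂ e₃ A) : wedgeEv e₁ e₂ e₃ ⊆ A := by
  rcases hA with rfl | rfl
  · intro ω hω; rcases hω with h | h <;> simp [or3Ev, h]
  · exact Set.subset_univ _

/-- An edge is not an absorber. [this work] -/
theorem not_isAbsorber_of_isEdge (h₁₂ : e₁ ≠ e₂) (h₁₃ : e₁ ≠ e₃) (h₂₃ : e₂ ≠ e₃) {X : Set (Set ι)} (hX : IsEdge e₁ e₂ e₃ X) :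
    ¬ IsAbsorber e₁ e₂ e₃ X := by
  have h₂₁ := h₁₂.symm; have h₃₁ := h₁₃.symm; have h₃₂ := h₂₃.symm
  rintro (h | h)
  · rcases hX with rfl | rfl | rfl
    · have : ({e₁} : Set ι) ∈ or3Ev e₁ e₂ e₃ := by simp [or3Ev]
      rw [← h] at this; simp [orEv, h₂₁, h₃₁] at this
    · have : ({e₂} : Set ι) ∈ or3Ev e₁ e₂ e₃ := by simp [or3Ev]
      rw [← h] at this; simp [orEv, h₁₂, h₃₂] at this
    · have : ({e₃} : Set ι) ∈ or3Ev e₁ e₂ e₃ := by simp [or3Ev]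
      rw [← h] at this; simp [orEv, h₁₃, h₂₃] at this
  · rcases hX with rfl | rfl | rfl
    all_goals
      have : (∅ : Set ι) ∈ (Set.univ : Set (Set ι)) := Set.mem_univ _
      rw [← h] at this; simp [orEv] at this

/-- The wedge is not an absorber. [this work] -/
theorem not_isAbsorber_wedgeEv (h₁₂ : e₁ ≠ e₂) (h₁₃ : e₁ ≠ e₃) : ¬ IsAbsorber e₁ e₂ e₃ (wedgeEv e₁ e₂ e₃) := by
  have h₂₁ := h₁₂.symm; have h₃₁ := h₁₃.symm
  rintro (h | h)
  · have : ({e₁} : Set ι) ∈ or3Ev e₁ e₂ e₃ := by simp [or3Ev]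
    rw [← h] at this; simp [wedgeEv, h₂₁, h₃₁] at this
  · have : (∅ : Set ι) ∈ (Set.univ : Set (Set ι)) := Set.mem_univ _
    rw [← h] at this; simp [wedgeEv] at this

/-- The wedge is not the edge `x₁ ∨ x₂`. [this work] -/
theorem wedgeEv_ne_orEv (h₁₂ : e₁ ≠ e₂) (h₁₃ : e₁ ≠ e₃) : wedgeEv e₁ e₂ e₃ ≠ orEv e₁ e₂ := by
  have h₂₁ := h₁₂.symm; have h₃₁ := h₁₃.symm
  intro h
  have : ({e₁} : Set ι) ∈ orEv e₁ e₂ := by simp [orEv]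
  rw [← h] at this; simp [wedgeEv, h₂₁, h₃₁] at this

/-- The three edges are pairwise distinct. [this work] -/
theorem orEv_ne (h₁₂ : e₁ ≠ e₂) (h₁₃ : e₁ ≠ e₃) (h₂₃ : e₂ ≠ e₃) :
    orEv e₂ e₃ ≠ orEv e₁ e₃ ∧ orEv e₂ e₃ ≠ orEv e₁ e₂ ∧ orEv e₁ e₃ ≠ orEv e₁ e₂ := by
  have h₂₁ := h₁₂.symm; have h₃₁ := h₁₃.symm; have h₃₂ := h₂₃.symm
  refine ⟨fun h => ?_, fun h => ?_, fun h => ?_⟩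
  · have : ({e₁} : Set ι) ∈ orEv e₁ e₃ := by simp [orEv]
    rw [← h] at this; simp [orEv, h₂₁, h₃₁] at this
  · have : ({e₁} : Set ι) ∈ orEv e₁ e₂ := by simp [orEv]
    rw [← h] at this; simp [orEv, h₂₁, h₃₁] at this
  · have : ({e₂} : Set ι) ∈ orEv e₁ e₂ := by simp [orEv]
    rw [← h] at this; simp [orEv, h₁₂, h₃₂] at this

end Events

/-! ### Triangle families and wedge families are not zero flags (every order) -/

section Families

variable {e₁ e₂ e₃ : ι} (h₁₂ : e₁ ≠ e₂) (h₁₃ : e₁ ≠ e₃) (h₂₃ : e₂ ≠ e₃)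

/-- A **triangle family**: every member is an edge of the OR-triangle or an absorber, and all three edges occur. [this work] -/
def TriFam (e₁ e₂ e₃ : ι) {k : ℕ} (U : Fin k → Set (Set ι)) : Prop :=
  (∀ j, IsEdge e₁ e₂ e₃ (U j) ∨ IsAbsorber e₁ e₂ e₃ (U j)) ∧
    (∃ j, U j = orEv e₂ e₃) ∧ (∃ j, U j = orEv e₁ e₃) ∧ (∃ j, U j = orEv e₁ e₂)

/-- A **wedge family**: every member is the wedge, the edge `x₁ ∨ x₂` or an absorber, and both the wedge and that edge occur.
[this work] -/
def WedgeFam (e₁ e₂ e₃ : ι) {k : ℕ} (U : Fin k → Set (Set ι)) : Prop :=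
  (∀ j, U j = wedgeEv e₁ e₂ e₃ ∨ U j = orEv e₁ e₂ ∨ IsAbsorber e₁ e₂ e₃ (U j)) ∧
    (∃ j, U j = wedgeEv e₁ e₂ e₃) ∧ (∃ j, U j = orEv e₁ e₂)

omit [Fintype ι] in
/-- A witness slot different from the peeled slot lies in the range of `succAbove` (plumbing). [folklore] -/
theorem exists_succAbove_of_ne {k : ℕ} {i j : Fin (k + 1)} (h : j ≠ i) : ∃ z : Fin k, i.succAbove z = j :=
  Fin.exists_succAbove_eq h

include h₁₂ h₁₃ h₂₃ in
/-- **Triangle families are not zero flags**, at every order `k + 2`. [this work] -/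
theorem not_suppZeroFlag_of_triFam : ∀ (k : ℕ) (U : Fin (k + 2) → Set (Set ι)), TriFam e₁ e₂ e₃ U → ¬ SuppZeroFlag (k + 2) U := by
  have hne := orEv_ne (ι := ι) h₁₂ h₁₃ h₂₃
  intro k
  induction k with
  | zero =>
    -- three distinct edges cannot occupy two slots
    rintro U ⟨-, ⟨j₁, hj₁⟩, ⟨j₂, hj₂⟩, ⟨j₃, hj₃⟩⟩ -
    have h12 : j₁ ≠ j₂ := fun h => hne.1 (hj₁ ▸ hj₂ ▸ (congrArg U h))
    have h13 : j₁ ≠ j₃ := fun h => hne.2.1 (hj₁ ▸ hj₃ ▸ (congrArg U h))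
    have h23 : j₂ ≠ j₃ := fun h => hne.2.2 (hj₂ ▸ hj₃ ▸ (congrArg U h))
    fin_cases j₁ <;> fin_cases j₂ <;> fin_cases j₃ <;> simp_all
  | succ k ih =>
    rintro U ⟨hmem, ⟨j₁, hj₁⟩, ⟨j₂, hj₂⟩, ⟨j₃, hj₃⟩⟩ hZ
    have hUup : ∀ j, IsUpperSet (U j) := fun j => (hmem j).elim isUpperSet_of_isEdge isUpperSet_of_isAbsorber
    obtain ⟨i, hi, hl⟩ := hZ
    rcases hmem i with hedge | habs
    · -- the peeled slot carries an edge
      by_cases hex : ∃ j, IsAbsorber e₁ e₂ e₃ (U j)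
      · -- shrink an absorber against the edge: the edge reappears, the family type is reproduced one order down
        obtain ⟨j, hj⟩ := hex
        have hji : j ≠ i := by rintro rfl; exact not_isAbsorber_of_isEdge h₁₂ h₁₃ h₂₃ hedge hj
        obtain ⟨l, rfl⟩ := exists_succAbove_of_ne hji
        refine ih _ ?_ (hl l)
        have hVl : update (fun j => U (i.succAbove j)) l (U (i.succAbove l) ∩ U i) l = U i := by
          rw [update_self]; exact Set.inter_eq_right.2 (subset_of_isEdge_of_isAbsorber hedge hj)
        have hVne : ∀ z, z ≠ l → update (fun j => U (i.succAbove j)) l (U (i.succAbove l) ∩ U i) z = U (i.succAbove z) :=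
          fun z hz => by rw [update_of_ne hz]
        -- witnesses: the peeled edge sits at `l`; the other two edges keep their (distinct) slots
        have wit : ∀ E : Set (Set ι), IsEdge e₁ e₂ e₃ E → (∃ j, U j = E) →
            ∃ z, update (fun j => U (i.succAbove j)) l (U (i.succAbove l) ∩ U i) z = E := by
          intro E hE ⟨j', hj'⟩
          by_cases hE' : U i = E
          · exact ⟨l, hVl.trans hE'⟩
          · have hj'i : j' ≠ i := by rintro rfl; exact hE' hj'
            obtain ⟨z, rfl⟩ := exists_succAbove_of_ne hj'i
            have hzl : z ≠ l := by rintro rfl; exact not_isAbsorber_of_isEdge h₁₂ h₁₃ h₂₃ (hj' ▸ hE) hj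
            exact ⟨z, (hVne z hzl).trans hj'⟩
        refine ⟨fun z => ?_, wit _ (Or.inl rfl) ⟨j₁, hj₁⟩, wit _ (Or.inr (Or.inl rfl)) ⟨j₂, hj₂⟩,
          wit _ (Or.inr (Or.inr rfl)) ⟨j₃, hj₃⟩⟩
        by_cases hz : z = l
        · subst hz; rw [hVl]; exact Or.inl hedge
        · rw [hVne z hz]; exact hmem _
      · -- no absorber: all members are edges, pairwise dependent, so the deleted family is no zero flag
        have hex' : ∀ j, ¬ IsAbsorber e₁ e₂ e₃ (U j) := fun j hj => hex ⟨j, hj⟩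
        refine not_suppZeroFlag_of_pairwise_affects _ (fun j => hUup _) (fun j j' _ => ?_) hi
        exact exists_affects_of_isEdge ((hmem _).resolve_right (hex' _)) ((hmem _).resolve_right (hex' _))
    · -- the peeled slot carries an absorber: the deleted family is again a triangle family
      refine ih _ ⟨fun z => hmem _, ?_, ?_, ?_⟩ hi
      · have h : j₁ ≠ i := by rintro rfl; exact not_isAbsorber_of_isEdge h₁₂ h₁₃ h₂₃ (Or.inl hj₁) habs
        obtain ⟨z, rfl⟩ := exists_succAbove_of_ne h; exact ⟨z, hj₁⟩
      · have h : j₂ ≠ i := by rintro rfl; exact not_isAbsorber_of_isEdge h₁₂ h₁₃ h₂₃ (Or.inr (Or.inl hj₂)) habs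
        obtain ⟨z, rfl⟩ := exists_succAbove_of_ne h; exact ⟨z, hj₂⟩
      · have h : j₃ ≠ i := by rintro rfl; exact not_isAbsorber_of_isEdge h₁₂ h₁₃ h₂₃ (Or.inr (Or.inr hj₃)) habs
        obtain ⟨z, rfl⟩ := exists_succAbove_of_ne h; exact ⟨z, hj₃⟩

include h₁₂ h₁₃ h₂₃ in
/-- **Wedge families are not zero flags**, at every order `k + 2`. [this work] -/
theorem not_suppZeroFlag_of_wedgeFam : ∀ (k : ℕ) (U : Fin (k + 2) → Set (Set ι)), WedgeFam e₁ e₂ e₃ U → ¬ SuppZeroFlag (k + 2) U := by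
  have hWE := wedgeEv_ne_orEv (ι := ι) h₁₂ h₁₃
  -- the wedge and the edge `x₁ ∨ x₂` both use `e₁`
  have hdep : ∀ X Y : Set (Set ι), (X = wedgeEv e₁ e₂ e₃ ∨ X = orEv e₁ e₂) → (Y = wedgeEv e₁ e₂ e₃ ∨ Y = orEv e₁ e₂) →
      ∃ i, Affects X i ∧ Affects Y i := by
    rintro X Y (rfl | rfl) (rfl | rfl)
    · exact ⟨e₁, affects_wedgeEv h₂₃ h₁₂, affects_wedgeEv h₂₃ h₁₂⟩
    · exact ⟨e₁, affects_wedgeEv h₂₃ h₁₂, affects_orEv_left _ _⟩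
    · exact ⟨e₁, affects_orEv_left _ _, affects_wedgeEv h₂₃ h₁₂⟩
    · exact ⟨e₁, affects_orEv_left _ _, affects_orEv_left _ _⟩
  have hup : ∀ X : Set (Set ι), (X = wedgeEv e₁ e₂ e₃ ∨ X = orEv e₁ e₂ ∨ IsAbsorber e₁ e₂ e₃ X) → IsUpperSet X := by
    rintro X (rfl | rfl | h)
    · exact isUpperSet_wedgeEv _ _ _
    · exact isUpperSet_orEv _ _
    · exact isUpperSet_of_isAbsorber h
  have hsub : ∀ X A : Set (Set ι), (X = wedgeEv e₁ e₂ e₃ ∨ X = orEv e₁ e₂) → IsAbsorber e₁ e₂ e₃ A → X ⊆ A := by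
    rintro X A (rfl | rfl) hA
    · exact wedgeEv_subset_of_isAbsorber hA
    · exact subset_of_isEdge_of_isAbsorber (Or.inr (Or.inr rfl)) hA
  have hnabs : ∀ X : Set (Set ι), (X = wedgeEv e₁ e₂ e₃ ∨ X = orEv e₁ e₂) → ¬ IsAbsorber e₁ e₂ e₃ X := by
    rintro X (rfl | rfl)
    · exact not_isAbsorber_wedgeEv h₁₂ h₁₃
    · exact not_isAbsorber_of_isEdge h₁₂ h₁₃ h₂₃ (Or.inr (Or.inr rfl))
  intro k
  induction k with
  | zero =>
    rintro U ⟨hmem, ⟨j₁, hj₁⟩, ⟨j₂, hj₂⟩⟩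
    refine not_suppZeroFlag_of_pairwise_affects U (fun j => hup _ (hmem j)) fun j j' hjj' => hdep _ _ ?_ ?_
    · have h12 : j₁ ≠ j₂ := fun h => hWE (hj₁ ▸ hj₂ ▸ congrArg U h)
      fin_cases j₁ <;> fin_cases j₂ <;> fin_cases j <;> simp_all
    · have h12 : j₁ ≠ j₂ := fun h => hWE (hj₁ ▸ hj₂ ▸ congrArg U h)
      fin_cases j₁ <;> fin_cases j₂ <;> fin_cases j' <;> simp_all
  | succ k ih =>
    rintro U ⟨hmem, ⟨j₁, hj₁⟩, ⟨j₂, hj₂⟩⟩ hZ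
    obtain ⟨i, hi, hl⟩ := hZ
    by_cases hspecial : U i = wedgeEv e₁ e₂ e₃ ∨ U i = orEv e₁ e₂
    · by_cases hex : ∃ j, IsAbsorber e₁ e₂ e₃ (U j)
      · obtain ⟨j, hj⟩ := hex
        have hji : j ≠ i := by rintro rfl; exact hnabs _ hspecial hj
        obtain ⟨l, rfl⟩ := exists_succAbove_of_ne hji
        refine ih _ ?_ (hl l)
        have hVl : update (fun j => U (i.succAbove j)) l (U (i.succAbove l) ∩ U i) l = U i := by
          rw [update_self]; exact Set.inter_eq_right.2 (hsub _ _ hspecial hj)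
        have hVne : ∀ z, z ≠ l → update (fun j => U (i.succAbove j)) l (U (i.succAbove l) ∩ U i) z = U (i.succAbove z) :=
          fun z hz => by rw [update_of_ne hz]
        have wit : ∀ E : Set (Set ι), (E = wedgeEv e₁ e₂ e₃ ∨ E = orEv e₁ e₂) → (∃ j, U j = E) →
            ∃ z, update (fun j => U (i.succAbove j)) l (U (i.succAbove l) ∩ U i) z = E := by
          intro E hE ⟨j', hj'⟩
          by_cases hE' : U i = E
          · exact ⟨l, hVl.trans hE'⟩
          · have hj'i : j' ≠ i := by rintro rfl; exact hE' hj'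
            obtain ⟨z, rfl⟩ := exists_succAbove_of_ne hj'i
            have hzl : z ≠ l := by rintro rfl; exact hnabs _ (hj' ▸ hE) hj
            exact ⟨z, (hVne z hzl).trans hj'⟩
        refine ⟨fun z => ?_, wit _ (Or.inl rfl) ⟨j₁, hj₁⟩, wit _ (Or.inr rfl) ⟨j₂, hj₂⟩⟩
        by_cases hz : z = l
        · subst hz; rw [hVl]; rcases hspecial with h | h
          · exact Or.inl h
          · exact Or.inr (Or.inl h)
        · rw [hVne z hz]; exact hmem _
      · have hex' : ∀ j, ¬ IsAbsorber e₁ e₂ e₃ (U j) := fun j hj => hex ⟨j, hj⟩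
        have hmem' : ∀ j, U j = wedgeEv e₁ e₂ e₃ ∨ U j = orEv e₁ e₂ := fun j => by
          rcases hmem j with h | h | h
          · exact Or.inl h
          · exact Or.inr h
          · exact absurd h (hex' j)
        exact not_suppZeroFlag_of_pairwise_affects _ (fun j => hup _ (hmem _)) (fun j j' _ => hdep _ _ (hmem' _) (hmem' _)) hi
    · have habs : IsAbsorber e₁ e₂ e₃ (U i) := by
        rcases hmem i with h | h | h
        · exact absurd (Or.inl h) hspecial
        · exact absurd (Or.inr h) hspecial
        · exact h
      refine ih _ ⟨fun z => hmem _, ?_, ?_⟩ hi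
      · have h : j₁ ≠ i := by rintro rfl; exact hnabs _ (Or.inl hj₁) habs
        obtain ⟨z, rfl⟩ := exists_succAbove_of_ne h; exact ⟨z, hj₁⟩
      · have h : j₂ ≠ i := by rintro rfl; exact hnabs _ (Or.inr hj₂) habs
        obtain ⟨z, rfl⟩ := exists_succAbove_of_ne h; exact ⟨z, hj₂⟩

end Families

end TrianglePatterns

end Summit.CriticalPhenomena.PercolationContinuityZ3.Theorems
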